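import Literature.NumberTheory.Transcendental.ExpOneTranscendenceMeasureParams
import HarnessLib

/-!
# Waldschmidt 1978, Corollary 3.9 (transcendence measure for `e^β`) — proofs, part IV:
# the parameters of the approximation measure for `e^β`

Sibling PROOFS file of `ExpAlgebraicTranscendenceMeasure.lean` (the named fact
`Literature.NumberTheory.Transcendental.Waldschmidt1978_cor_3_9`). Everything here is PROVED; no
definitions, no named facts. Pure real-number inequalities: the verification that the choice

  `T₁ = 100 D Λ`, `S₁ = 2500 D Λ`, `T = 250000 g D V Λ`, `S = 130000 g D V Λ`

of the parameters of the core contradiction of part III (`Waldschmidt1978.approx_core`) satisfies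
its counting condition and its main inequality, in the shape used there. Here (in the proof of
Theorem 3.8 of [Waldschmidt1978], next part) `D = [ℚ(β):ℚ] · deg ξ`, `E = Y ≥ log 16` is the bound
for `log M(ξ)`, `a = log Y (≥ 1)`, `V = ⌈Y/a⌉`, `Λ = ⌈λ⌉` with `λ = 1 + (log D + κ)/a`,
`κ = 20 + g + C_h` (`g ≥ [ℚ(β):ℚ], max(1,|β|)`; `C_h ≥ h(β)`), following the pattern of
[NesterenkoWaldschmidt1996, §6 d)] (their `U, V, W`): every one of the ten terms of the left-hand
side of the main inequality is at most `T T₁ a / 20` (`Waldschmidt1978.perL_le`), whence the main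
inequality (`Waldschmidt1978.main_ineq`); the counting condition (`Waldschmidt1978.counts`); and the
size of `L a + log N + 3N log B` against the final constant (`Waldschmidt1978.smallness_budget`).

## References

* [NesterenkoWaldschmidt1996] Yu. V. Nesterenko, M. Waldschmidt, Mat. Zapiski 2 (1996) 23–42
  (arXiv:math/0002047), §6 d) (6.4)–(6.11).
* [Waldschmidt1978] M. Waldschmidt, J. Austral. Math. Soc. (A) 25 (1978) 445–465, Theorem 3.8
  (the choice `V = (1/N) Log M (1+|β|)`, `D = dN`, `E = Log M`, p. 454).
-/

noncomputable section

namespace Literature.NumberTheory.Transcendental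

namespace Waldschmidt1978

open NW1996

/-! ### Numerical logarithms -/

/-- `log 100 ≤ 5`, `log 2500 ≤ 8`, `log 250000 ≤ 13`, `log 2 ≤ 1`, `log 6 ≤ 2` (`2.7 < e`).
[folklore] -/
theorem log_consts :
    Real.log 100 ≤ 5 ∧ Real.log 2500 ≤ 8 ∧ Real.log 250000 ≤ 13 ∧ Real.log 2 ≤ 1 ∧ Real.log 6 ≤ 2 := by
  refine ⟨?_, ?_, ?_, ?_, ?_⟩
  · exact (log_lt_nat_of_lt_pow (by norm_num) 5 (by norm_num)).le.trans (by norm_num)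
  · exact (log_lt_nat_of_lt_pow (by norm_num) 8 (by norm_num)).le.trans (by norm_num)
  · exact (log_lt_nat_of_lt_pow (by norm_num) 13 (by norm_num)).le.trans (by norm_num)
  · exact (log_lt_nat_of_lt_pow (by norm_num) 1 (by norm_num)).le.trans (by norm_num)
  · exact (log_lt_nat_of_lt_pow (by norm_num) 2 (by norm_num)).le.trans (by norm_num)

/-! ### Logarithms of the parameters -/

section Logs

variable {D g a Λ V Ch : ℝ}

/-- `log x ≤ x` for `x ≥ 1` (indeed `log x ≤ x - 1`). [folklore] -/
theorem log_le_self_of_one_le {x : ℝ} (hx : 1 ≤ x) : Real.log x ≤ x := by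
  have := Real.log_le_sub_one_of_pos (by linarith : 0 < x); linarith

/-- `log T₁ = log (100 D Λ) ≤ 2aΛ` under `log D + κ ≤ a(Λ-1)`, `κ = 20 + g + C_h`. [folklore] -/
theorem log_T₁_le (hD : 1 ≤ D) (hg : 1 ≤ g) (ha : 1 ≤ a) (hΛ : 1 ≤ Λ) (hCh : 0 ≤ Ch)
    (hK : Real.log D + (20 + g + Ch) ≤ a * (Λ - 1)) :
    Real.log (100 * D * Λ) ≤ 2 * a * Λ := by
  have hD0 : 0 < D := by linarith
  have hΛ0 : 0 < Λ := by linarith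
  rw [Real.log_mul (by positivity) hΛ0.ne', Real.log_mul (by norm_num) hD0.ne']
  have h1 := log_consts.1
  have h2 := log_le_self_of_one_le hΛ
  have h3 : Λ ≤ a * Λ := le_mul_of_one_le_left hΛ0.le ha
  nlinarith

/-- `log S₁ = log (2500 D Λ) ≤ 2aΛ`. [folklore] -/
theorem log_S₁_le (hD : 1 ≤ D) (hg : 1 ≤ g) (ha : 1 ≤ a) (hΛ : 1 ≤ Λ) (hCh : 0 ≤ Ch)
    (hK : Real.log D + (20 + g + Ch) ≤ a * (Λ - 1)) :
    Real.log (2500 * D * Λ) ≤ 2 * a * Λ := by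
  have hD0 : 0 < D := by linarith
  have hΛ0 : 0 < Λ := by linarith
  rw [Real.log_mul (by positivity) hΛ0.ne', Real.log_mul (by norm_num) hD0.ne']
  have h1 := log_consts.2.1
  have h2 := log_le_self_of_one_le hΛ
  have h3 : Λ ≤ a * Λ := le_mul_of_one_le_left hΛ0.le ha
  nlinarith

/-- `log T = log (250000 g D V Λ) ≤ aΛ + a + Λ` when moreover `log V ≤ 2a`. [folklore] -/
theorem log_T_le (hD : 1 ≤ D) (hg : 1 ≤ g) (_ha : 1 ≤ a) (hΛ : 1 ≤ Λ) (hV : 1 ≤ V) (hCh : 0 ≤ Ch)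
    (hlogV : Real.log V ≤ 2 * a) (hK : Real.log D + (20 + g + Ch) ≤ a * (Λ - 1)) :
    Real.log (250000 * g * D * V * Λ) ≤ a * Λ + a + Λ := by
  have hD0 : 0 < D := by linarith
  have hΛ0 : 0 < Λ := by linarith
  have hg0 : 0 < g := by linarith
  have hV0 : 0 < V := by linarith
  rw [Real.log_mul (by positivity) hΛ0.ne', Real.log_mul (by positivity) hV0.ne',
    Real.log_mul (by positivity) hD0.ne', Real.log_mul (by norm_num) hg0.ne']
  have h1 := log_consts.2.2.1
  have h2 := log_le_self_of_one_le hΛ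
  have h3 := log_le_self_of_one_le hg
  nlinarith

/-- `log (T + T₁) ≤ 4aΛ`. [folklore] -/
theorem log_TT₁_le (hD : 1 ≤ D) (hg : 1 ≤ g) (ha : 1 ≤ a) (hΛ : 1 ≤ Λ) (hV : 1 ≤ V) (hCh : 0 ≤ Ch)
    (hlogV : Real.log V ≤ 2 * a) (hK : Real.log D + (20 + g + Ch) ≤ a * (Λ - 1)) :
    Real.log (250000 * g * D * V * Λ + 100 * D * Λ) ≤ 4 * a * Λ := by
  have hD0 : 0 < D := by linarith
  have hΛ0 : 0 < Λ := by linarith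
  have hDΛ : 0 < D * Λ := mul_pos hD0 hΛ0
  -- `T + T₁ ≤ 2T`
  have hle : 250000 * g * D * V * Λ + 100 * D * Λ ≤ 2 * (250000 * g * D * V * Λ) := by
    have : 100 * (D * Λ) ≤ 250000 * g * V * (D * Λ) := by
      have hgV : (1 : ℝ) ≤ g * V := one_le_mul_of_one_le_of_one_le hg hV
      nlinarith
    nlinarith
  have hpos : 0 < 250000 * g * D * V * Λ + 100 * D * Λ := by positivity
  calc Real.log (250000 * g * D * V * Λ + 100 * D * Λ)
      ≤ Real.log (2 * (250000 * g * D * V * Λ)) := Real.log_le_log hpos hle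
    _ = Real.log 2 + Real.log (250000 * g * D * V * Λ) := by
        rw [Real.log_mul (by norm_num) (by positivity)]
    _ ≤ 1 + (a * Λ + a + Λ) := add_le_add log_consts.2.2.2.1 (log_T_le hD hg ha hΛ hV hCh hlogV hK)
    _ ≤ 4 * a * Λ := by
        have h3 : Λ ≤ a * Λ := le_mul_of_one_le_left hΛ0.le ha
        have h4 : a ≤ a * Λ := le_mul_of_one_le_right (by linarith) hΛ
        have h5 : 1 ≤ a * Λ := one_le_mul_of_one_le_of_one_le ha hΛ
        linarith

/-- `log L ≤ 7aΛ` for `L = (T+1)(2T₁+1) ≤ 6 T T₁`. [folklore] -/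
theorem log_L_le (hD : 1 ≤ D) (hg : 1 ≤ g) (ha : 1 ≤ a) (hΛ : 1 ≤ Λ) (hV : 1 ≤ V) (hCh : 0 ≤ Ch)
    (hlogV : Real.log V ≤ 2 * a) (hK : Real.log D + (20 + g + Ch) ≤ a * (Λ - 1)) :
    Real.log ((250000 * g * D * V * Λ + 1) * (2 * (100 * D * Λ) + 1)) ≤ 7 * a * Λ := by
  have hD0 : 0 < D := by linarith
  have hΛ0 : 0 < Λ := by linarith
  set T := 250000 * g * D * V * Λ with hT
  set T₁ := 100 * D * Λ with hT₁
  have hT1 : 1 ≤ T := by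
    rw [hT]
    have h1 : (1 : ℝ) ≤ 250000 * g := by nlinarith
    calc (1 : ℝ) ≤ 250000 * g := h1
      _ ≤ 250000 * g * D := le_mul_of_one_le_right (by positivity) hD
      _ ≤ 250000 * g * D * V := le_mul_of_one_le_right (by positivity) hV
      _ ≤ 250000 * g * D * V * Λ := le_mul_of_one_le_right (by positivity) hΛ
  have hT₁1 : 1 ≤ T₁ := by
    rw [hT₁]
    calc (1 : ℝ) ≤ 100 := by norm_num
      _ ≤ 100 * D := le_mul_of_one_le_right (by norm_num) hD
      _ ≤ 100 * D * Λ := le_mul_of_one_le_right (by positivity) hΛ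
  have hT0 : 0 < T := by linarith
  have hT₁0 : 0 < T₁ := by linarith
  have hle : (T + 1) * (2 * T₁ + 1) ≤ 6 * (T * T₁) := by nlinarith
  calc Real.log ((T + 1) * (2 * T₁ + 1)) ≤ Real.log (6 * (T * T₁)) :=
        Real.log_le_log (by positivity) hle
    _ = Real.log 6 + Real.log T + Real.log T₁ := by
        rw [Real.log_mul (by norm_num) (by positivity), Real.log_mul hT0.ne' hT₁0.ne']; ring
    _ ≤ 2 + (a * Λ + a + Λ) + 2 * a * Λ :=
        add_le_add (add_le_add log_consts.2.2.2.2 (log_T_le hD hg ha hΛ hV hCh hlogV hK))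
          (log_T₁_le hD hg ha hΛ hCh hK)
    _ ≤ 7 * a * Λ := by
        have h3 : Λ ≤ a * Λ := le_mul_of_one_le_left hΛ0.le ha
        have h4 : a ≤ a * Λ := le_mul_of_one_le_right (by linarith) hΛ
        have h5 : 1 ≤ a * Λ := one_le_mul_of_one_le_of_one_le ha hΛ
        linarith

end Logs

/-! ### The ten terms and the main inequality per unit of `L` -/

/-- **The main inequality per unit of `L`.** With `T₁ = 100DΛ`, `S₁ = 2500DΛ`, `T = 250000 gDVΛ`,
`S = 130000 gDVΛ` and the hypotheses of the parameter choice, the ten terms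
`log 2`, `(1+D) log L`, `(1+D) T log S₁`, `(1+D) S log(T+T₁)`, `T a`, `S log β₊`, `T₁ β₊ Y S₁`, `S a`,
`S D C_h`, `S₁T₁(2dY + log B)` are each `≤ T T₁ a / 20`, so their sum is `≤ T T₁ a / 2`.
(`Bud` in the proof is `T T₁ a / 20 = 1250000 · g D² V Λ² a`.)
[cite: NesterenkoWaldschmidt1996, §6 d)] -/
theorem perL_le {D g a Λ V Ch βp dr Y lB T T₁ S S₁ : ℝ} (hD : 1 ≤ D) (hg : 1 ≤ g) (ha : 1 ≤ a)
    (hΛ : 1 ≤ Λ) (hV : 1 ≤ V) (hCh : 0 ≤ Ch) (hβp : 1 ≤ βp) (hβpg : βp ≤ g)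
    (hdrg : dr ≤ g) (hY0 : 0 ≤ Y) (hYaV : Y ≤ a * V) (hlBg : lB ≤ 2 * g)
    (hlogV : Real.log V ≤ 2 * a) (hK : Real.log D + (20 + g + Ch) ≤ a * (Λ - 1))
    (hT₁ : T₁ = 100 * D * Λ) (hS₁ : S₁ = 2500 * D * Λ) (hT : T = 250000 * g * D * V * Λ)
    (hS : S = 130000 * g * D * V * Λ) :
    Real.log 2 + (1 + D) * Real.log ((T + 1) * (2 * T₁ + 1)) +
      (1 + D) * (T * Real.log S₁ + S * Real.log (T + T₁)) +
      (T * a + S * Real.log βp + T₁ * βp * Y * S₁) + S * a + S * (D * Ch) +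
      S₁ * T₁ * (2 * (dr * Y) + lB) ≤ T * T₁ * a / 2 := by
  have hD0 : 0 < D := by linarith
  have hΛ0 : 0 < Λ := by linarith
  have hg0 : 0 < g := by linarith
  have hV0 : 0 < V := by linarith
  have ha0 : 0 < a := by linarith
  -- basic products
  have hDΛ1 : 1 ≤ D * Λ := one_le_mul_of_one_le_of_one_le hD hΛ
  have haΛ1 : 1 ≤ a * Λ := one_le_mul_of_one_le_of_one_le ha hΛ
  have haV1 : 1 ≤ a * V := one_le_mul_of_one_le_of_one_le ha hV
  have hΛaΛ : Λ ≤ a * Λ := le_mul_of_one_le_left hΛ0.le ha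
  -- `κ ≤ a(Λ-1) ≤ aΛ`, so `g, Ch, log βp ≤ aΛ`
  have hlogD0 : 0 ≤ Real.log D := Real.log_nonneg hD
  have hκ : 20 + g + Ch ≤ a * Λ := by nlinarith
  have hgaΛ : g ≤ a * Λ := by linarith
  have hChaΛ : Ch ≤ a * Λ := by linarith
  have hlogβp : Real.log βp ≤ a * Λ := by
    have := log_le_self_of_one_le hβp; linarith
  have hlogβp0 : 0 ≤ Real.log βp := Real.log_nonneg hβp
  -- the values of `T`, `T₁` are `≥ 1`
  have hTv1 : (1 : ℝ) ≤ 250000 * g * D * V * Λ := by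
    have h1 : (1 : ℝ) ≤ 250000 * g := by nlinarith
    calc (1 : ℝ) ≤ 250000 * g := h1
      _ ≤ 250000 * g * D := le_mul_of_one_le_right (by positivity) hD
      _ ≤ 250000 * g * D * V := le_mul_of_one_le_right (by positivity) hV
      _ ≤ 250000 * g * D * V * Λ := le_mul_of_one_le_right (by positivity) hΛ
  have hT₁v1 : (1 : ℝ) ≤ 100 * D * Λ := by
    calc (1 : ℝ) ≤ 100 := by norm_num
      _ ≤ 100 * D := le_mul_of_one_le_right (by norm_num) hD
      _ ≤ 100 * D * Λ := le_mul_of_one_le_right (by positivity) hΛ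
  have hS₁v1 : (1 : ℝ) ≤ 2500 * D * Λ := by linarith
  -- the budget `Bud = T T₁ a / 20` and the unit `U = g D² V Λ² a`
  set U : ℝ := g * D ^ 2 * V * Λ ^ 2 * a with hU
  have hU0 : 0 < U := by rw [hU]; positivity
  set Bud : ℝ := 1250000 * U with hBud
  have hBudeq : T * T₁ * a / 20 = Bud := by rw [hT, hT₁, hBud, hU]; ring
  -- comparisons of monomials with `U`
  have m1 : D * a * Λ ≤ U := by
    rw [hU]
    have h2 : g * D ^ 2 * V * Λ ^ 2 * a = (g * V * (D * Λ)) * (D * a * Λ) := by ring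
    rw [h2]
    refine le_mul_of_one_le_left (by positivity) ?_
    exact one_le_mul_of_one_le_of_one_le (one_le_mul_of_one_le_of_one_le hg hV) hDΛ1
  have m2 : g * D * V * Λ * a ≤ U := by
    rw [hU]
    have h2 : g * D ^ 2 * V * Λ ^ 2 * a = g * D * V * Λ * a * (D * Λ) := by ring
    rw [h2]; exact le_mul_of_one_le_right (by positivity) hDΛ1
  have m3 : g * D * V * Λ * (a * Λ) ≤ U := by
    rw [hU]
    have h2 : g * D ^ 2 * V * Λ ^ 2 * a = g * D * V * Λ * (a * Λ) * D := by ring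
    rw [h2]; exact le_mul_of_one_le_right (by positivity) hD
  have m4 : g * D ^ 2 * V * Λ * (a * Λ) = U := by rw [hU]; ring
  have m5 : D ^ 2 * Λ ^ 2 * (g * (a * V)) = U := by rw [hU]; ring
  have m6 : (1 : ℝ) ≤ U := le_trans hDΛ1 (by
    have : D * Λ ≤ U := by
      rw [hU]
      have h2 : g * D ^ 2 * V * Λ ^ 2 * a = (D * Λ) * (g * V * (D * Λ) * a) := by ring
      rw [h2]
      refine le_mul_of_one_le_right (by positivity) ?_
      exact one_le_mul_of_one_le_of_one_le
        (one_le_mul_of_one_le_of_one_le (one_le_mul_of_one_le_of_one_le hg hV) hDΛ1) ha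
    exact this)
  -- t1
  have t1 : Real.log 2 ≤ Bud := by
    have := log_consts.2.2.2.1; rw [hBud]; linarith
  -- t2 : (1+D) log L ≤ 2D · 7aΛ = 14 DaΛ
  have t2 : (1 + D) * Real.log ((T + 1) * (2 * T₁ + 1)) ≤ Bud := by
    have hlogL := log_L_le hD hg ha hΛ hV hCh hlogV hK
    rw [hT, hT₁]
    have hlogL0 : 0 ≤ Real.log ((250000 * g * D * V * Λ + 1) * (2 * (100 * D * Λ) + 1)) :=
      Real.log_nonneg (one_le_mul_of_one_le_of_one_le (by linarith) (by linarith))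
    have h1 : (1 + D) * Real.log ((250000 * g * D * V * Λ + 1) * (2 * (100 * D * Λ) + 1)) ≤
        (2 * D) * (7 * a * Λ) := mul_le_mul (by linarith) hlogL hlogL0 (by positivity)
    have h2 : (2 * D) * (7 * a * Λ) = 14 * (D * a * Λ) := by ring
    rw [hBud]; linarith [m1]
  -- t3 : (1+D) T log S₁ ≤ 2D T · 2aΛ = 10⁶ U
  have t3 : (1 + D) * (T * Real.log S₁) ≤ Bud := by
    have hlogS₁ := log_S₁_le hD hg ha hΛ hCh hK
    rw [hS₁, hT]
    have hlog0 : 0 ≤ Real.log (2500 * D * Λ) := Real.log_nonneg hS₁v1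
    have hT0 : 0 ≤ 250000 * g * D * V * Λ := by positivity
    have h1 : (1 + D) * (250000 * g * D * V * Λ * Real.log (2500 * D * Λ)) ≤
        (2 * D) * (250000 * g * D * V * Λ * (2 * a * Λ)) :=
      mul_le_mul (by linarith) (mul_le_mul_of_nonneg_left hlogS₁ hT0) (by positivity) (by positivity)
    have h2 : (2 * D) * (250000 * g * D * V * Λ * (2 * a * Λ)) = 1000000 * U := by rw [hU]; ring
    rw [hBud]; linarith
  -- t4 : (1+D) S log(T+T₁) ≤ 2D S · 4aΛ = 1040000 U
  have t4 : (1 + D) * (S * Real.log (T + T₁)) ≤ Bud := by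
    have hlogTT₁ := log_TT₁_le hD hg ha hΛ hV hCh hlogV hK
    rw [hS, hT, hT₁]
    have hlog0 : 0 ≤ Real.log (250000 * g * D * V * Λ + 100 * D * Λ) := Real.log_nonneg (by linarith)
    have hS0 : 0 ≤ 130000 * g * D * V * Λ := by positivity
    have h1 : (1 + D) * (130000 * g * D * V * Λ * Real.log (250000 * g * D * V * Λ + 100 * D * Λ)) ≤
        (2 * D) * (130000 * g * D * V * Λ * (4 * a * Λ)) :=
      mul_le_mul (by linarith) (mul_le_mul_of_nonneg_left hlogTT₁ hS0) (by positivity) (by positivity)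
    have h2 : (2 * D) * (130000 * g * D * V * Λ * (4 * a * Λ)) = 1040000 * U := by rw [hU]; ring
    rw [hBud]; linarith
  -- t5 : T a ≤ 250000 U
  have t5 : T * a ≤ Bud := by
    rw [hT, hBud]
    have : 250000 * g * D * V * Λ * a = 250000 * (g * D * V * Λ * a) := by ring
    linarith [m2]
  -- t6 : S log βp ≤ 130000 g D V Λ · aΛ ≤ 130000 U
  have t6 : S * Real.log βp ≤ Bud := by
    rw [hS, hBud]
    have h1 : 130000 * g * D * V * Λ * Real.log βp ≤ 130000 * g * D * V * Λ * (a * Λ) :=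
      mul_le_mul_of_nonneg_left hlogβp (by positivity)
    have h2 : 130000 * g * D * V * Λ * (a * Λ) = 130000 * (g * D * V * Λ * (a * Λ)) := by ring
    linarith [m3]
  -- t7 : T₁ βp Y S₁ ≤ 250000 D² Λ² g (aV) = 250000 U
  have t7 : T₁ * βp * Y * S₁ ≤ Bud := by
    rw [hT₁, hS₁, hBud]
    have h1 : 100 * D * Λ * βp * Y * (2500 * D * Λ) = 250000 * (D ^ 2 * Λ ^ 2 * (βp * Y)) := by ring
    have h2 : βp * Y ≤ g * (a * V) := mul_le_mul hβpg hYaV hY0 hg0.le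
    have h3 : D ^ 2 * Λ ^ 2 * (βp * Y) ≤ D ^ 2 * Λ ^ 2 * (g * (a * V)) :=
      mul_le_mul_of_nonneg_left h2 (by positivity)
    linarith [m5]
  -- t8 : S a ≤ 130000 U
  have t8 : S * a ≤ Bud := by
    rw [hS, hBud]
    have : 130000 * g * D * V * Λ * a = 130000 * (g * D * V * Λ * a) := by ring
    linarith [m2]
  -- t9 : S D Ch ≤ 130000 g D² V Λ · aΛ = 130000 U
  have t9 : S * (D * Ch) ≤ Bud := by
    rw [hS, hBud]
    have h1 : 130000 * g * D * V * Λ * (D * Ch) = 130000 * (g * D ^ 2 * V * Λ) * Ch := by ring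
    have h2 : 130000 * (g * D ^ 2 * V * Λ) * Ch ≤ 130000 * (g * D ^ 2 * V * Λ) * (a * Λ) :=
      mul_le_mul_of_nonneg_left hChaΛ (by positivity)
    have h3 : 130000 * (g * D ^ 2 * V * Λ) * (a * Λ) = 130000 * U := by rw [← m4]; ring
    linarith
  -- t10 : S₁T₁(2 dr Y + lB) ≤ 250000 D²Λ² · 4 g aV = 10⁶ U
  have t10 : S₁ * T₁ * (2 * (dr * Y) + lB) ≤ Bud := by
    rw [hS₁, hT₁, hBud]
    have h1 : 2500 * D * Λ * (100 * D * Λ) * (2 * (dr * Y) + lB) =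
        250000 * (D ^ 2 * Λ ^ 2) * (2 * (dr * Y) + lB) := by ring
    have h2 : dr * Y ≤ g * (a * V) := mul_le_mul hdrg hYaV hY0 hg0.le
    have h3 : lB ≤ 2 * (g * (a * V)) := by
      have : g ≤ g * (a * V) := le_mul_of_one_le_right hg0.le haV1
      linarith
    have h4 : 2 * (dr * Y) + lB ≤ 4 * (g * (a * V)) := by linarith
    have h5 : 250000 * (D ^ 2 * Λ ^ 2) * (2 * (dr * Y) + lB) ≤ 250000 * (D ^ 2 * Λ ^ 2) * (4 * (g * (a * V))) :=
      mul_le_mul_of_nonneg_left h4 (by positivity)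
    have h6 : 250000 * (D ^ 2 * Λ ^ 2) * (4 * (g * (a * V))) = 1000000 * U := by rw [← m5]; ring
    linarith
  -- sum: `10 · Bud = T T₁ a / 2`
  have e : (1 + D) * (T * Real.log S₁ + S * Real.log (T + T₁)) =
      (1 + D) * (T * Real.log S₁) + (1 + D) * (S * Real.log (T + T₁)) := by ring
  have htarget : T * T₁ * a / 2 = 10 * Bud := by rw [← hBudeq]; ring
  rw [e, htarget]
  linarith only [t1, t2, t3, t4, t5, t6, t7, t8, t9, t10]

/-! ### The main inequality in the shape of `approx_core` -/

/-- **The main inequality of the core** (`Waldschmidt1978.approx_core`, hypothesis `hmain`) for the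
parameters `T₁ = 100DΛ`, `S₁ = 2500DΛ`, `T = 250000gDVΛ`, `S = 130000gDVΛ` (natural numbers),
with `Dr = D`, `H_β = D C_h`, `H_ξ = d Y`, `E = Y` (`a = log Y`), `log B = lB`: from `perL_le`,
`m ≤ L S₁ T₁` and `L - 1 ≥ 2 T T₁`. [cite: NesterenkoWaldschmidt1996, §6 d)] -/
theorem main_ineq {D g Λ V Ch βp dr Y lB : ℝ} {T T₁ S S₁ : ℕ} (hD : 1 ≤ D) (hg : 1 ≤ g)
    (hΛ : 1 ≤ Λ) (hV : 1 ≤ V) (hCh : 0 ≤ Ch) (hβp : 1 ≤ βp) (hβpg : βp ≤ g) (hdr0 : 0 ≤ dr)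
    (hdrg : dr ≤ g) (hY : Real.log 16 ≤ Y) (ha : 1 ≤ Real.log Y) (hYaV : Y ≤ Real.log Y * V)
    (hlB0 : 0 ≤ lB) (hlBg : lB ≤ 2 * g) (hlogV : Real.log V ≤ 2 * Real.log Y)
    (hK : Real.log D + (20 + g + Ch) ≤ Real.log Y * (Λ - 1))
    (hT₁ : (T₁ : ℝ) = 100 * D * Λ) (hS₁ : (S₁ : ℝ) = 2500 * D * Λ) (hT : (T : ℝ) = 250000 * g * D * V * Λ)
    (hS : (S : ℝ) = 130000 * g * D * V * Λ) :
    (((T + 1) * (2 * T₁ + 1) : ℕ) : ℝ) * Real.log 2 +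
        (1 + D) * (((T + 1) * (2 * T₁ + 1) : ℕ) : ℝ) * Real.log (((T + 1) * (2 * T₁ + 1) : ℕ) : ℝ) +
        (1 + D) * (((T + 1) * (2 * T₁ + 1) : ℕ) : ℝ) *
          (T * Real.log S₁ + S * Real.log ((T : ℝ) + T₁)) +
        (((T + 1) * (2 * T₁ + 1) : ℕ) : ℝ) *
          (T * Real.log Y + S * Real.log βp + T₁ * βp * Y * S₁) +
        (((T + 1) * (2 * T₁ + 1) : ℕ) : ℝ) * S * Real.log Y +
        (((T + 1) * (2 * T₁ + 1) : ℕ) : ℝ) * S * (D * Ch) +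
        2 * ((S₁ * (T + 1) * (T₁ * (T₁ + 1)) : ℕ) : ℝ) * (dr * Y) +
        ((S₁ * (T + 1) * (T₁ * (T₁ + 1)) : ℕ) : ℝ) * lB <
      (((T + 1) * (2 * T₁ + 1) : ℕ) : ℝ) * ((((T + 1) * (2 * T₁ + 1) : ℕ) : ℝ) - 1) / 2 * Real.log Y := by
  set a := Real.log Y with ha_def
  have hY0 : 0 ≤ Y := le_trans (Real.log_nonneg (by norm_num)) hY
  have hper := perL_le hD hg ha hΛ hV hCh hβp hβpg hdrg hY0 hYaV hlBg hlogV hK hT₁ hS₁ hT hS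
  -- casts
  set L : ℝ := (((T + 1) * (2 * T₁ + 1) : ℕ) : ℝ) with hL
  set m : ℝ := ((S₁ * (T + 1) * (T₁ * (T₁ + 1)) : ℕ) : ℝ) with hm
  have hLeq : L = ((T : ℝ) + 1) * (2 * T₁ + 1) := by rw [hL]; push_cast; ring
  have hmeq : m = (S₁ : ℝ) * (T + 1) * (T₁ * (T₁ + 1)) := by rw [hm]; push_cast; ring
  clear_value L m
  have hT0 : (0 : ℝ) ≤ T := Nat.cast_nonneg _
  have hT₁0 : (0 : ℝ) ≤ T₁ := Nat.cast_nonneg _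
  have hS₁0 : (0 : ℝ) ≤ S₁ := Nat.cast_nonneg _
  have hS0 : (0 : ℝ) ≤ S := Nat.cast_nonneg _
  have hT₁1 : (1 : ℝ) ≤ T₁ := by
    rw [hT₁]
    calc (1 : ℝ) ≤ 100 := by norm_num
      _ ≤ 100 * D := le_mul_of_one_le_right (by norm_num) hD
      _ ≤ 100 * D * Λ := le_mul_of_one_le_right (by positivity) hΛ
  have hLpos : 0 < L := by rw [hLeq]; positivity
  -- `m ≤ L S₁ T₁` and `2 T T₁ ≤ L - 1`
  have hmL : m ≤ L * S₁ * T₁ := by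
    rw [hmeq, hLeq]
    have h1 : (T₁ : ℝ) + 1 ≤ 2 * T₁ + 1 := by linarith
    have h0 : 0 ≤ (S₁ : ℝ) * (T + 1) * T₁ := by positivity
    calc (S₁ : ℝ) * (T + 1) * (T₁ * (T₁ + 1)) = (S₁ : ℝ) * (T + 1) * T₁ * (T₁ + 1) := by ring
      _ ≤ (S₁ : ℝ) * (T + 1) * T₁ * (2 * T₁ + 1) := mul_le_mul_of_nonneg_left h1 h0
      _ = ((T : ℝ) + 1) * (2 * T₁ + 1) * S₁ * T₁ := by ring
  have hL1 : 2 * (T : ℝ) * T₁ ≤ L - 1 := by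
    have e : L - 1 - 2 * (T : ℝ) * T₁ = T + 2 * T₁ := by rw [hLeq]; ring
    linarith only [e, hT0, hT₁0]
  -- the non-`L` part
  have hX0 : 0 ≤ 2 * (dr * Y) + lB := by positivity
  have hmterm : 2 * m * (dr * Y) + m * lB ≤ L * (S₁ * T₁ * (2 * (dr * Y) + lB)) := by
    have : 2 * m * (dr * Y) + m * lB = m * (2 * (dr * Y) + lB) := by ring
    rw [this]
    calc m * (2 * (dr * Y) + lB) ≤ (L * S₁ * T₁) * (2 * (dr * Y) + lB) :=
          mul_le_mul_of_nonneg_right hmL hX0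
      _ = L * (S₁ * T₁ * (2 * (dr * Y) + lB)) := by ring
  -- assemble: LHS ≤ L · (per-L sum) ≤ L · T T₁ a / 2 < L · T T₁ a ≤ L (L-1)/2 · a
  have hTT₁a : 0 < (T : ℝ) * T₁ * a := by
    have hT1 : (1 : ℝ) ≤ T := by
      rw [hT]
      have h1 : (1 : ℝ) ≤ 250000 * g := by nlinarith
      calc (1 : ℝ) ≤ 250000 * g := h1
        _ ≤ 250000 * g * D := le_mul_of_one_le_right (by positivity) hD
        _ ≤ 250000 * g * D * V := le_mul_of_one_le_right (by positivity) hV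
        _ ≤ 250000 * g * D * V * Λ := le_mul_of_one_le_right (by positivity) hΛ
    have : 0 < a := by linarith
    positivity
  have key : L * Real.log 2 + (1 + D) * L * Real.log L + (1 + D) * L * (T * Real.log S₁ + S * Real.log ((T : ℝ) + T₁)) +
        L * (T * a + S * Real.log βp + T₁ * βp * Y * S₁) + L * S * a + L * S * (D * Ch) +
        2 * m * (dr * Y) + m * lB ≤ L * ((T : ℝ) * T₁ * a / 2) := by
    have e : L * Real.log 2 + (1 + D) * L * Real.log L + (1 + D) * L * (T * Real.log S₁ + S * Real.log ((T : ℝ) + T₁)) +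
        L * (T * a + S * Real.log βp + T₁ * βp * Y * S₁) + L * S * a + L * S * (D * Ch) =
        L * (Real.log 2 + (1 + D) * Real.log L + (1 + D) * (T * Real.log S₁ + S * Real.log ((T : ℝ) + T₁)) +
          (T * a + S * Real.log βp + T₁ * βp * Y * S₁) + S * a + S * (D * Ch)) := by ring
    have hper' : Real.log 2 + (1 + D) * Real.log L + (1 + D) * (T * Real.log S₁ + S * Real.log ((T : ℝ) + T₁)) +
        (T * a + S * Real.log βp + T₁ * βp * Y * S₁) + S * a + S * (D * Ch) +
        S₁ * T₁ * (2 * (dr * Y) + lB) ≤ (T : ℝ) * T₁ * a / 2 := by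
      rw [hLeq]; exact hper
    calc _ = L * (Real.log 2 + (1 + D) * Real.log L + (1 + D) * (T * Real.log S₁ + S * Real.log ((T : ℝ) + T₁)) +
          (T * a + S * Real.log βp + T₁ * βp * Y * S₁) + S * a + S * (D * Ch)) +
          (2 * m * (dr * Y) + m * lB) := by rw [← e]; ring
      _ ≤ L * (Real.log 2 + (1 + D) * Real.log L + (1 + D) * (T * Real.log S₁ + S * Real.log ((T : ℝ) + T₁)) +
          (T * a + S * Real.log βp + T₁ * βp * Y * S₁) + S * a + S * (D * Ch)) +
          L * (S₁ * T₁ * (2 * (dr * Y) + lB)) := add_le_add le_rfl hmterm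
      _ = L * (Real.log 2 + (1 + D) * Real.log L + (1 + D) * (T * Real.log S₁ + S * Real.log ((T : ℝ) + T₁)) +
          (T * a + S * Real.log βp + T₁ * βp * Y * S₁) + S * a + S * (D * Ch) +
          S₁ * T₁ * (2 * (dr * Y) + lB)) := by ring
      _ ≤ L * ((T : ℝ) * T₁ * a / 2) := mul_le_mul_of_nonneg_left hper' hLpos.le
  have hfin : L * ((T : ℝ) * T₁ * a / 2) < L * (L - 1) / 2 * a := by
    have h1 : L * ((T : ℝ) * T₁ * a / 2) < L * ((T : ℝ) * T₁ * a) := by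
      apply mul_lt_mul_of_pos_left _ hLpos; linarith
    have h2 : L * ((T : ℝ) * T₁ * a) ≤ L * (L - 1) / 2 * a := by
      have ha0 : 0 ≤ a := by linarith
      have : L * ((T : ℝ) * T₁ * a) = (L * (2 * T * T₁) / 2) * a := by ring
      rw [this]
      refine mul_le_mul_of_nonneg_right ?_ ha0
      apply div_le_div_of_nonneg_right _ (by norm_num)
      exact mul_le_mul_of_nonneg_left hL1 hLpos.le
    exact lt_of_lt_of_le h1 h2
  exact lt_of_le_of_lt key hfin

/-! ### The counting condition of the zero estimate -/

/-- **The counting conditions** `2T₁ ≤ S + 1` and `(2T₁+1) T < (S + 1 - 2T₁)(2S₁+1)` for the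
chosen parameters. [cite: NesterenkoWaldschmidt1996, §6 Lemma 6] -/
theorem counts {D g Λ V : ℝ} {T T₁ S S₁ : ℕ} (hD : 1 ≤ D) (hg : 1 ≤ g) (hΛ : 1 ≤ Λ) (hV : 1 ≤ V)
    (hT₁ : (T₁ : ℝ) = 100 * D * Λ) (hS₁ : (S₁ : ℝ) = 2500 * D * Λ) (hT : (T : ℝ) = 250000 * g * D * V * Λ)
    (hS : (S : ℝ) = 130000 * g * D * V * Λ) :
    1 ≤ T₁ ∧ 1 ≤ S₁ ∧ 2 * T₁ ≤ S + 1 ∧ (2 * T₁ + 1) * T < (S + 1 - 2 * T₁) * (2 * S₁ + 1) := by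
  have hD0 : 0 < D := by linarith
  have hΛ0 : 0 < Λ := by linarith
  have hDΛ : 1 ≤ D * Λ := one_le_mul_of_one_le_of_one_le hD hΛ
  have hgV : 1 ≤ g * V := one_le_mul_of_one_le_of_one_le hg hV
  have hT₁r : (1 : ℝ) ≤ T₁ := by rw [hT₁]; nlinarith
  have hS₁r : (1 : ℝ) ≤ S₁ := by rw [hS₁]; nlinarith
  have hT₁1 : 1 ≤ T₁ := by exact_mod_cast hT₁r
  have hS₁1 : 1 ≤ S₁ := by exact_mod_cast hS₁r
  -- `2 T₁ ≤ S` as reals: `200 D Λ ≤ 130000 g D V Λ`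
  have h2r : 2 * (T₁ : ℝ) ≤ S := by
    rw [hT₁, hS]
    have : 200 * (D * Λ) ≤ 130000 * (g * V) * (D * Λ) := by nlinarith
    nlinarith
  have h2 : 2 * T₁ ≤ S := by exact_mod_cast h2r
  refine ⟨hT₁1, hS₁1, by omega, ?_⟩
  -- the strict count, as reals with `S + 1 - 2T₁ = (S - 2T₁) + 1`
  have hsub : ((S + 1 - 2 * T₁ : ℕ) : ℝ) = (S : ℝ) + 1 - 2 * T₁ := by
    rw [Nat.cast_sub (by omega)]; push_cast; ring
  have hr : (((2 * T₁ + 1) * T : ℕ) : ℝ) < (((S + 1 - 2 * T₁) * (2 * S₁ + 1) : ℕ) : ℝ) := by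
    rw [Nat.cast_mul, Nat.cast_mul, hsub]
    push_cast
    rw [hT₁, hT, hS, hS₁]
    -- `(200DΛ+1)·250000gDVΛ < (130000gDVΛ + 1 - 200DΛ)(5000DΛ+1)`
    have hx : 0 < D * Λ := by positivity
    have hgV0 : 0 < g * V := by positivity
    nlinarith [mul_pos (mul_pos hx hx) hgV0, mul_pos hx hgV0]
  exact_mod_cast hr

/-! ### The size of the parameters against the final constant -/

/-- **Budget for the smallness hypothesis**: `L a + log N + 3 N lB ≤ 1.25·10⁹ · g D² V Λ² a`
(`L = (T+1)(2T₁+1) ≤ 6TT₁`, `N = T₁S₁`, `lB ≤ 2g`). [folklore] -/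
theorem smallness_budget {D g a Λ V lB : ℝ} {T T₁ S₁ : ℕ} (hD : 1 ≤ D) (hg : 1 ≤ g) (ha : 1 ≤ a)
    (hΛ : 1 ≤ Λ) (hV : 1 ≤ V) (hlBg : lB ≤ 2 * g)
    (hT₁ : (T₁ : ℝ) = 100 * D * Λ) (hS₁ : (S₁ : ℝ) = 2500 * D * Λ) (hT : (T : ℝ) = 250000 * g * D * V * Λ) :
    (((T + 1) * (2 * T₁ + 1) : ℕ) : ℝ) * a + Real.log ((T₁ * S₁ : ℕ) : ℝ) +
        3 * ((T₁ * S₁ : ℕ) : ℝ) * lB ≤ 160000000 * (g * D ^ 2 * V * Λ ^ 2 * a) := by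
  set U : ℝ := g * D ^ 2 * V * Λ ^ 2 * a with hU
  have hD0 : 0 < D := by linarith
  have hΛ0 : 0 < Λ := by linarith
  have hDΛ : 1 ≤ D * Λ := one_le_mul_of_one_le_of_one_le hD hΛ
  have haV1 : 1 ≤ a * V := one_le_mul_of_one_le_of_one_le ha hV
  have hT₁r : (1 : ℝ) ≤ T₁ := by rw [hT₁]; nlinarith
  have hTr : (1 : ℝ) ≤ T := by
    rw [hT]
    have h1 : (1 : ℝ) ≤ 250000 * g := by nlinarith
    calc (1 : ℝ) ≤ 250000 * g := h1
      _ ≤ 250000 * g * D := le_mul_of_one_le_right (by positivity) hD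
      _ ≤ 250000 * g * D * V := le_mul_of_one_le_right (by positivity) hV
      _ ≤ 250000 * g * D * V * Λ := le_mul_of_one_le_right (by positivity) hΛ
  -- `L ≤ 6 T T₁`
  have hL : (((T + 1) * (2 * T₁ + 1) : ℕ) : ℝ) ≤ 6 * ((T : ℝ) * T₁) := by push_cast; nlinarith
  have hLa : (((T + 1) * (2 * T₁ + 1) : ℕ) : ℝ) * a ≤ 150000000 * U := by
    have h1 : (((T + 1) * (2 * T₁ + 1) : ℕ) : ℝ) * a ≤ 6 * ((T : ℝ) * T₁) * a :=
      mul_le_mul_of_nonneg_right hL (by linarith)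
    have h2 : 6 * ((T : ℝ) * T₁) * a = 150000000 * U := by rw [hT, hT₁, hU]; ring
    linarith
  -- `N = T₁ S₁ = 250000 D² Λ²`, `log N + 3 N lB ≤ 7 g N ≤ 1750000 U`
  have hN : ((T₁ * S₁ : ℕ) : ℝ) = 250000 * (D ^ 2 * Λ ^ 2) := by push_cast; rw [hT₁, hS₁]; ring
  have hN1 : (1 : ℝ) ≤ ((T₁ * S₁ : ℕ) : ℝ) := by rw [hN]; nlinarith [one_le_mul_of_one_le_of_one_le hDΛ hDΛ]
  have hlogN : Real.log ((T₁ * S₁ : ℕ) : ℝ) ≤ ((T₁ * S₁ : ℕ) : ℝ) := log_le_self_of_one_le hN1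
  have hNU : ((T₁ * S₁ : ℕ) : ℝ) * g ≤ 250000 * U := by
    rw [hN, hU]
    have : D ^ 2 * Λ ^ 2 * g ≤ g * D ^ 2 * V * Λ ^ 2 * a := by
      have e : g * D ^ 2 * V * Λ ^ 2 * a = D ^ 2 * Λ ^ 2 * g * (a * V) := by ring
      rw [e]; exact le_mul_of_one_le_right (by positivity) haV1
    nlinarith
  have hg1 : ((T₁ * S₁ : ℕ) : ℝ) ≤ ((T₁ * S₁ : ℕ) : ℝ) * g :=
    le_mul_of_one_le_right (by linarith) hg
  have h3 : 3 * ((T₁ * S₁ : ℕ) : ℝ) * lB ≤ 6 * (((T₁ * S₁ : ℕ) : ℝ) * g) := by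
    have h0 : 0 ≤ ((T₁ * S₁ : ℕ) : ℝ) := by linarith
    nlinarith
  linarith

/-- **The final constant absorbs the parameters.** With `D = d·n`, `aV ≤ 2Y`,
`aΛ ≤ 2(a + log D + κ)` (`κ = 20 + g + C_h ≥ 0`), `a ≥ 1`, `n, d ≥ 1`:
`g D² V Λ² a ≤ 8 g d² (1 + log d + κ)² · n² Y (a + log n)²/a²`. [folklore] -/
theorem unit_le_final {d n g a Λ V Y κ : ℝ} (hd : 1 ≤ d) (hn : 1 ≤ n) (hg : 1 ≤ g) (ha : 1 ≤ a)
    (hΛ : 1 ≤ Λ) (hV : 1 ≤ V) (hκ : 0 ≤ κ) (haV : a * V ≤ 2 * Y)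
    (haΛ : a * Λ ≤ 2 * (a + Real.log (d * n) + κ)) :
    g * (d * n) ^ 2 * V * Λ ^ 2 * a ≤
      8 * g * d ^ 2 * (1 + Real.log d + κ) ^ 2 * (n ^ 2 * Y * (a + Real.log n) ^ 2 / a ^ 2) := by
  have ha0 : 0 < a := by linarith
  have hd0 : 0 < d := by linarith
  have hn0 : 0 < n := by linarith
  have hlogd : 0 ≤ Real.log d := Real.log_nonneg hd
  have hlogn : 0 ≤ Real.log n := Real.log_nonneg hn
  -- `a + log(dn) + κ ≤ (1 + log d + κ)(a + log n)`
  have hkey : a + Real.log (d * n) + κ ≤ (1 + Real.log d + κ) * (a + Real.log n) := by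
    rw [Real.log_mul hd0.ne' hn0.ne']
    have h1 : 1 ≤ a + Real.log n := by linarith
    nlinarith [mul_nonneg (add_nonneg hlogd hκ) (by linarith : (0 : ℝ) ≤ a + Real.log n - 1)]
  -- `(aΛ)² ≤ 4 (1 + log d + κ)² (a + log n)²`
  have hΛsq : (a * Λ) ^ 2 ≤ 4 * ((1 + Real.log d + κ) * (a + Real.log n)) ^ 2 := by
    have h0 : 0 ≤ a * Λ := by positivity
    have h1 : a * Λ ≤ 2 * ((1 + Real.log d + κ) * (a + Real.log n)) := by linarith
    calc (a * Λ) ^ 2 ≤ (2 * ((1 + Real.log d + κ) * (a + Real.log n))) ^ 2 := pow_le_pow_left₀ h0 h1 2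
      _ = 4 * ((1 + Real.log d + κ) * (a + Real.log n)) ^ 2 := by ring
  -- rewrite the left-hand side as `g d² n² (aV) (aΛ)² / a²`
  have e : g * (d * n) ^ 2 * V * Λ ^ 2 * a = g * d ^ 2 * n ^ 2 * (a * V) * (a * Λ) ^ 2 / a ^ 2 := by
    field_simp; try ring
  rw [e, div_le_iff₀ (by positivity)]
  have hY0 : 0 ≤ Y := by nlinarith [mul_pos ha0 (by linarith : (0:ℝ) < V)]
  calc g * d ^ 2 * n ^ 2 * (a * V) * (a * Λ) ^ 2
      ≤ g * d ^ 2 * n ^ 2 * (2 * Y) * (4 * ((1 + Real.log d + κ) * (a + Real.log n)) ^ 2) := by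
        gcongr
    _ = 8 * g * d ^ 2 * (1 + Real.log d + κ) ^ 2 * (n ^ 2 * Y * (a + Real.log n) ^ 2 / a ^ 2) * a ^ 2 := by
        field_simp; try ring

end Waldschmidt1978

end Literature.NumberTheory.Transcendental

end
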